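import Summits.QuantumFields.YangMills.Theorems.PencilRigidityDiagonalMirrorRPRStubRpClosureDefs

/-!
# Crux `DiagonalMirrorRPR` (stmt-QuantumFields-10604), line `centre-twisted-swap` (absorbed into the lead's tree of
# `kms-variance-lukewarm-descent`): vocabulary of the centre-twisted swap reflection

Routes `PencilRigidity` / `MirrorModularBoosts` of `YangMills`, crux `DiagonalMirrorRPR`
(`Summit.QuantumFields.YangMills.Theses.MirrorModularBoosts.DiagonalMirrorRPR`, shared verbatim with the `PencilRigidity`
copy).  This module is the VOCABULARY ROOT of the centre-side stubs of the registered skeleton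
`Cruxes/DiagonalMirrorRPR/Lines/centre_twisted_swap.lean` (§1 there, VERBATIM, same namespace `…CentreTwistedSwap`, so
that the registered stub signatures `stub_twistedSwapRP` (S1') and `stub_rpClosureTwisted` (S4'') elaborate unchanged
against it): the centre twist `centreTwist`, the twisted swap `twistSwapConfig = C_z ∘ θ^*` on the configurations of the
Fröhlich–Israel–Lieb–Simon 45° torus `T̃_N` (`TConfig (2N) N N`, landed in `…StubRpClosureDefs`), and the twisted
reflection-positivity statement `CoverTwistedSwapRPAt ρ z β N`, which for `z = 1` is the landed `CoverSwapRPAt ρ β N`.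

Idea (card `Ideas/centre-twisted-swap.md`): for a central `z` with `ρ(z) = −𝟙` the reflection `Θ'_z = C_z ∘ θ^*`
flips exactly the sign of the diagonal Schur cut of the `(0,1)`-plaquettes based on the mirror layers, so Wilson's
measure on `T̃_N` is `Θ'_z`-RP for `β ≤ 0` (S1'), and on gauge-invariant functions of plaquettes `Θ'_z`-RP is plain
swap-RP (S4'').

References: Fröhlich–Israel–Lieb–Simon, Comm. Math. Phys. 62 (1978) Thm 2.1; FILS II, J. Stat. Phys. 22 (1980) §3;
't Hooft, Nucl. Phys. B153 (1979) 141 (centre flux); Borgs–Seiler, Comm. Math. Phys. 91 (1983) 329.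
-/

set_option autoImplicit false

noncomputable section

open scoped ComplexConjugate
open MeasureTheory
open Literature.MathematicalPhysics.QuantumLattice Literature.MathematicalPhysics.QuantumFieldTheory

namespace Summit.QuantumFields.YangMills.Cruxes.DiagonalMirrorRPR.CentreTwistedSwap

open ParityBridgeColdTraces

/-! ## §1 The centre twist and the twisted swap reflection on the 45° torus -/

section Twist

variable {N : ℕ} {G : Type*} [Group G]

/-- The centre twist `C_z`: every `e₁`-edge variable multiplied on the left by `z`.  For central `z` it leaves every
plaquette holonomy, hence Wilson's action and every gauge-invariant function of plaquettes, unchanged; it is NOT a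
gauge transformation of `T̃_N` (a loop winding the `w`-circle once meets `N` `e₁`-edges, `z^N = z` for odd `N`). -/
def centreTwist (z : G) (U : TConfig (2 * N) N N G) : TConfig (2 * N) N N G :=
  fun e => (if e.2 = 1 then z else 1) * U e

/-- The twisted swap `Θ'_z = C_z ∘ θ^*`: `(Θ'_z U)(e) = z^{[e is an e₁-edge]} · U(swapEdge e)`. -/
def twistSwapConfig (z : G) (U : TConfig (2 * N) N N G) : TConfig (2 * N) N N G :=
  fun e => (if e.2 = 1 then z else 1) * U (swapEdge e)

/-- `Θ'_z = C_z ∘ θ^*` (definitionally). -/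
theorem twistSwapConfig_eq (z : G) (U : TConfig (2 * N) N N G) :
    twistSwapConfig z U = centreTwist z (swapConfig U) := rfl

/-- The trivial twist is the plain swap: `Θ'_1 = θ^*`. -/
@[simp] theorem twistSwapConfig_one (U : TConfig (2 * N) N N G) : twistSwapConfig (1 : G) U = swapConfig U := by
  funext e
  simp only [twistSwapConfig, swapConfig, Function.comp_apply, ite_self, one_mul]

/-- The trivial centre twist is the identity. -/
@[simp] theorem centreTwist_one (U : TConfig (2 * N) N N G) : centreTwist (1 : G) U = U := by
  funext e
  simp only [centreTwist, ite_self, one_mul]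

/-- On an `e₁`-edge the centre twist multiplies by `z`. -/
@[simp] theorem centreTwist_apply_one (z : G) (U : TConfig (2 * N) N N G) (y : TSite (2 * N) N N) :
    centreTwist z U (y, 1) = z * U (y, 1) := by
  show (if (1 : Fin 4) = 1 then z else 1) * U (y, 1) = z * U (y, 1)
  rw [if_pos rfl]

/-- Off the `e₁`-edges the centre twist does nothing. -/
theorem centreTwist_apply_of_ne (z : G) (U : TConfig (2 * N) N N G) {k : Fin 4} (hk : k ≠ 1)
    (y : TSite (2 * N) N N) : centreTwist z U (y, k) = U (y, k) := by
  show (if k = 1 then z else 1) * U (y, k) = U (y, k)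
  rw [if_neg hk, one_mul]

end Twist

/-! ### The centre twist is a symmetry of every plaquette holonomy (hence of Wilson's action) -/

section CentreInvariance

variable {N : ℕ} {G : Type*} [Group G] {z : G}

/-- `i = 1 ≠ j`: the two `e₁`-links of the plaquette are its first (forward) and third (inverse) factors. -/
private theorem twist_plaq_left (hz : ∀ g : G, g * z = z * g) (a b c d : G) :
    z * a * b * (z * c)⁻¹ * d⁻¹ = a * b * c⁻¹ * d⁻¹ := by
  have h1 : z * a * b * (z * c)⁻¹ = a * b * c⁻¹ := by
    rw [mul_inv_rev, ← hz a, mul_assoc a z b, ← hz b, ← mul_assoc a b z, mul_assoc (a * b) z (c⁻¹ * z⁻¹),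
      ← mul_assoc z c⁻¹ z⁻¹, ← hz c⁻¹, mul_inv_cancel_right]
  rw [h1]

/-- `i ≠ 1 = j`: the two `e₁`-links of the plaquette are its second (forward) and fourth (inverse) factors. -/
private theorem twist_plaq_right (hz : ∀ g : G, g * z = z * g) (a b c d : G) :
    a * (z * b) * c⁻¹ * (z * d)⁻¹ = a * b * c⁻¹ * d⁻¹ := by
  rw [mul_inv_rev, ← hz b, ← mul_assoc a b z, mul_assoc (a * b) z c⁻¹, ← hz c⁻¹, ← mul_assoc (a * b) c⁻¹ z,
    mul_assoc (a * b * c⁻¹) z (d⁻¹ * z⁻¹), ← mul_assoc z d⁻¹ z⁻¹, ← hz d⁻¹, mul_inv_cancel_right]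

/-- **Every plaquette holonomy of `T̃_N` is invariant under the centre twist** (central `z`; every site, every
direction pair — the `e₁`-links of a plaquette come as one forward and one inverse factor). -/
theorem tplaq_centreTwist (hz : z ∈ Subgroup.center G) (U : TConfig (2 * N) N N G) (x : TSite (2 * N) N N)
    (i j : Fin 4) : tplaq true (centreTwist z U) x i j = tplaq true U x i j := by
  have hc : ∀ g : G, g * z = z * g := fun g => Subgroup.mem_center_iff.1 hz g
  unfold tplaq
  by_cases hi : i = 1 <;> by_cases hj : j = 1
  · subst hi; subst hj
    simp only [centreTwist_apply_one, mul_inv_cancel_right, mul_inv_cancel]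
  · subst hi
    simp only [centreTwist_apply_one, centreTwist_apply_of_ne z U hj]
    exact twist_plaq_left hc _ _ _ _
  · subst hj
    simp only [centreTwist_apply_one, centreTwist_apply_of_ne z U hi]
    exact twist_plaq_right hc _ _ _ _
  · simp only [centreTwist_apply_of_ne z U hi, centreTwist_apply_of_ne z U hj]

/-- **Wilson's action on `T̃_N` is invariant under the centre twist** (so `A₊ ∘ Θ'_z = A₊ ∘ θ^* = A₋`, and every
function of plaquette holonomies is `C_z`-invariant). -/
theorem taction_centreTwist [NeZero N] {Nc : ℕ} (ρ : G →* Matrix (Fin Nc) (Fin Nc) ℂ)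
    (hz : z ∈ Subgroup.center G) (U : TConfig (2 * N) N N G) :
    taction ρ true (centreTwist z U) = taction ρ true U := by
  simp only [taction, tplaq_centreTwist hz]

/-- The Boltzmann weight is invariant under the centre twist, at every coupling of either sign. -/
theorem tweight_centreTwist [NeZero N] {Nc : ℕ} (ρ : G →* Matrix (Fin Nc) (Fin Nc) ℂ) (β : ℝ)
    (hz : z ∈ Subgroup.center G) (U : TConfig (2 * N) N N G) :
    tweight ρ β true (centreTwist z U) = tweight ρ β true U := by
  simp only [tweight, taction_centreTwist ρ hz]

/-- **Registered sub-goal `stub_tweight_centreTwist` (the certificate both round-2 triagers named as the cheapest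
falsifier of the centre-twisted swap): Wilson's Boltzmann weight on the sheared 45° torus is invariant under the
centre twist `C_z` for every central `z`, every `β`, every `N`.** -/
theorem stub_tweight_centreTwist :
    ∀ {N : ℕ} [NeZero N] {G : Type} [Group G] {Nc : ℕ} (ρ : G →* Matrix (Fin Nc) (Fin Nc) ℂ) (β : ℝ) {z : G},
      z ∈ Subgroup.center G → ∀ U : TConfig (2 * N) N N G, tweight ρ β true (centreTwist z U) = tweight ρ β true U :=
  fun ρ β _ hz U => tweight_centreTwist ρ β hz U

end CentreInvariance

/-! ## §2 The twisted reflection-positivity statement -/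

section TwistedRP

variable {G : Type} [Group G] [TopologicalSpace G] [IsTopologicalGroup G] [CompactSpace G]
  [MeasurableSpace G] [BorelSpace G] {Nc : ℕ}

/-- **`Θ'_z`-reflection positivity of Wilson's measure on `T̃_N` at `(ρ, β)`**: for every bounded measurable `F`
depending only on the edges of the closed positive half, `⟨conj(F ∘ Θ'_z) · F⟩_β ≥ 0` (real and non-negative).
For `z = 1` this is `CoverSwapRPAt ρ β N` (`coverTwistedSwapRPAt_one_iff`). -/
def CoverTwistedSwapRPAt (ρ : G →* Matrix (Fin Nc) (Fin Nc) ℂ) (z : G) (β : ℝ) (N : ℕ) [NeZero N] : Prop :=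
  ∀ F : TConfig (2 * N) N N G → ℂ, Measurable F → (∃ C : ℝ, ∀ U, ‖F U‖ ≤ C) →
    DependsOn F (posEdges N) →
      0 ≤ (texp ρ β true fun U => conj (F (twistSwapConfig z U)) * F U).re ∧
        (texp ρ β true fun U => conj (F (twistSwapConfig z U)) * F U).im = 0

/-- Untwisted (`z = 1`) twisted RP is the plain swap-RP `CoverSwapRPAt` of the line `parity-bridge-cold-traces`. -/
theorem coverTwistedSwapRPAt_one_iff (ρ : G →* Matrix (Fin Nc) (Fin Nc) ℂ) (β : ℝ) (N : ℕ) [NeZero N] :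
    CoverTwistedSwapRPAt ρ 1 β N ↔ CoverSwapRPAt ρ β N := by
  simp only [CoverTwistedSwapRPAt, CoverSwapRPAt, twistSwapConfig_one]

end TwistedRP

end Summit.QuantumFields.YangMills.Cruxes.DiagonalMirrorRPR.CentreTwistedSwap

end
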